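import Mathlib.LinearAlgebra.Matrix.Permanent
import Mathlib.LinearAlgebra.Matrix.Determinant.Basic
import Mathlib.Analysis.SpecialFunctions.Pow.Real

/-!
# Route SliceSignRank — crux `SrkNotQP` (stmt-ValiantsHypothesis-20857), line `forster_slice`:
# Forster's inequality for the permutation slice holds for BALANCED representations

The registered stub `stub_forsterSlice` of `Cruxes/SrkNotQP/Lines/forster_slice.lean` (the bet of the
line; verbatim the birth stub of crux `SignRankSuperQP`) says: there is an exponent `C` such that every
`k`-term sign-representation `sgn σ · Σ_t Π_i W_t(σ i, i) > 0 (∀ σ ∈ S_n)` forces ONE real twist `V`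
with `det V ≠ 0` and `n! · per(V ∘ V) ≤ k^C · det(V)²`.

This file proves the inequality in the one regime where Forster's matrix argument transfers
verbatim — the BALANCED (isotropic-position-like) regime named in the line card as the first honest
surrogate: if every term and every value of the representing function `F(σ) = Σ_t Π_i W_t(σ i, i)`
are within a factor `B` of each other in absolute value,

  `|Π_i W_t(σ i, i)| ≤ B · |F(σ)|` for all `t, σ`  and  `|F(σ)| ≤ B · |F(τ)|` for all `σ, τ`,

then the twist `V = W_{t*}` of largest determinant satisfies `det V > 0` and
`n! · per(V ∘ V) ≤ B³ · k² · det(V)²` (`forsterSlice_of_balanced`). With `B ≤ k^c` this is the stub's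
conclusion with exponent `C = 3c + 2`.

Dictionary (the two identities that make the slice model "Forster-shaped", both one-line
consequences of Leibniz' formula): `⟨sgn, φ_W⟩ = det W` (`sum_sign_mul_prod_eq_det`) and
`‖φ_W‖² = per(W ∘ W)` (`sum_prod_sq_eq_permanent`), where `φ_W(σ) = Π_i W(σ i, i)`.

Proof of the balanced inequality (three lines, as in Forster once isotropy is granted): with
`T = Σ_σ |F(σ)| = Σ_σ sgn σ · F(σ) = Σ_t det(W_t) ≤ k · det(V)` (averaging: `exists_det_ge_of_signRep`),
`per(V ∘ V) = Σ_σ φ_V(σ)² ≤ B² Σ_σ F(σ)² ≤ B² · (B · min_σ |F|) · T ≤ B³ · T² / n!`.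

HONEST CALIBRATION. This does NOT prove the stub: the whole difficulty of `stub_forsterSlice` is that a
short representation may be wildly unbalanced (huge terms with cancellation), and the slice model has
no analogue of Forster's `GL_k` isotropic-position step (its sign-preserving symmetries are only the
positive torus, which rescales every term by the same constant). The stub, the crux `SrkNotQP`, its
sibling `SignRankSuperQP` remain OPEN; `VP ≠ VNP` is not touched. Landed `--supports
stmt-ValiantsHypothesis-20857` as the typed surrogate requested by the line card.

References: [Forster2002] J. Forster, *A linear lower bound on the unbounded error probabilistic
communication complexity*, JCSS 65 (2002) 612–625, Thm 2.2; [RazborovSherstov2010] §1.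
-/

-- Sub = Summit layout duplicates the namespace component
set_option linter.dupNamespace false

namespace Summit.ValiantsHypothesis.ValiantsHypothesis.Theorems.SliceSignRank.SrkNotQP

open Finset Equiv

/-! ## §1 The dictionary: correlations with `sgn` are determinants, squared norms are permanents -/

/-- **Leibniz, read as a correlation**: `Σ_σ sgn σ · Π_i W(σ i, i) = det W`. [folklore] -/
theorem sum_sign_mul_prod_eq_det {n : ℕ} (W : Matrix (Fin n) (Fin n) ℝ) :
    ∑ σ : Perm (Fin n), ((Perm.sign σ : ℤ) : ℝ) * ∏ i, W (σ i) i = W.det :=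
  (Matrix.det_apply' W).symm

/-- **Squared `L²`-norm of a monomial function is a permanent**:
`Σ_σ (Π_i W(σ i, i))² = per(W ∘ W)`, `W ∘ W` the entrywise square. [folklore] -/
theorem sum_prod_sq_eq_permanent {n : ℕ} (W : Matrix (Fin n) (Fin n) ℝ) :
    ∑ σ : Perm (Fin n), (∏ i, W (σ i) i) ^ 2 = (Matrix.of fun i j => W i j ^ 2).permanent := by
  unfold Matrix.permanent
  refine Finset.sum_congr rfl fun σ _ => ?_
  rw [← Finset.prod_pow]
  rfl

/-- The real cast of a permutation sign has absolute value `1`. [folklore] -/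
theorem abs_sign_cast {n : ℕ} (σ : Perm (Fin n)) : |((Perm.sign σ : ℤ) : ℝ)| = 1 := by
  rcases Int.units_eq_one_or (Perm.sign σ) with h | h <;> simp [h]

/-- In a sign-representation, `|F(σ)| = sgn σ · F(σ)`. [folklore] -/
theorem abs_eq_sign_mul_of_pos {n : ℕ} (σ : Perm (Fin n)) (x : ℝ)
    (h : 0 < ((Perm.sign σ : ℤ) : ℝ) * x) : |x| = ((Perm.sign σ : ℤ) : ℝ) * x := by
  rcases Int.units_eq_one_or (Perm.sign σ) with hs | hs
  · simp only [hs, Units.val_one, Int.cast_one, one_mul] at h ⊢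
    exact abs_of_pos h
  · simp only [hs, Units.val_neg, Units.val_one, Int.cast_neg, Int.cast_one, neg_mul, one_mul,
      Left.neg_pos_iff] at h ⊢
    exact abs_of_neg h

/-! ## §2 Averaging: some twist carries a `1/k` share of the total mass -/

/-- **The total mass of a sign-representation is a sum of determinants**:
`Σ_σ |F(σ)| = Σ_t det(W_t)` for `F(σ) = Σ_t Π_i W_t(σ i, i)` with `sgn σ · F(σ) > 0`. [folklore] -/
theorem sum_abs_eq_sum_det {n k : ℕ} (W : Fin k → Matrix (Fin n) (Fin n) ℝ)
    (hrep : ∀ σ : Perm (Fin n), 0 < ((Perm.sign σ : ℤ) : ℝ) * ∑ t, ∏ i, W t (σ i) i) :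
    ∑ σ : Perm (Fin n), |∑ t, ∏ i, W t (σ i) i| = ∑ t, (W t).det := by
  calc ∑ σ : Perm (Fin n), |∑ t, ∏ i, W t (σ i) i|
      = ∑ σ : Perm (Fin n), ((Perm.sign σ : ℤ) : ℝ) * ∑ t, ∏ i, W t (σ i) i :=
        Finset.sum_congr rfl fun σ _ => abs_eq_sign_mul_of_pos σ _ (hrep σ)
    _ = ∑ σ : Perm (Fin n), ∑ t, ((Perm.sign σ : ℤ) : ℝ) * ∏ i, W t (σ i) i :=
        Finset.sum_congr rfl fun σ _ => Finset.mul_sum _ _ _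
    _ = ∑ t, ∑ σ : Perm (Fin n), ((Perm.sign σ : ℤ) : ℝ) * ∏ i, W t (σ i) i := Finset.sum_comm
    _ = ∑ t, (W t).det := Finset.sum_congr rfl fun t _ => sum_sign_mul_prod_eq_det (W t)

/-- A sign-representation has at least one term (`k = 0` gives the empty sum `0`). [folklore] -/
theorem pos_of_signRep {n k : ℕ} (W : Fin k → Matrix (Fin n) (Fin n) ℝ)
    (hrep : ∀ σ : Perm (Fin n), 0 < ((Perm.sign σ : ℤ) : ℝ) * ∑ t, ∏ i, W t (σ i) i) : 0 < k := by
  rcases Nat.eq_zero_or_pos k with hk | hk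
  · subst hk
    have h := hrep 1
    simp at h
  · exact hk

/-- **Averaging**: in a `k`-term sign-representation of `sgn` on `S_n` some twist `W_{t*}` has
`Σ_σ |F(σ)| ≤ k · det(W_{t*})`; in particular `det(W_{t*}) > 0`. [folklore] -/
theorem exists_det_ge_of_signRep {n k : ℕ} (W : Fin k → Matrix (Fin n) (Fin n) ℝ)
    (hrep : ∀ σ : Perm (Fin n), 0 < ((Perm.sign σ : ℤ) : ℝ) * ∑ t, ∏ i, W t (σ i) i) :
    ∃ t : Fin k, (∑ σ : Perm (Fin n), |∑ s, ∏ i, W s (σ i) i|) ≤ (k : ℝ) * (W t).det ∧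
      0 < (W t).det := by
  have hk : 0 < k := pos_of_signRep W hrep
  have hne : (Finset.univ : Finset (Fin k)).Nonempty :=
    Finset.univ_nonempty_iff.mpr ⟨⟨0, hk⟩⟩
  obtain ⟨t, -, ht⟩ := Finset.exists_max_image Finset.univ (fun s => (W s).det) hne
  have hsum : ∑ s, (W s).det ≤ (k : ℝ) * (W t).det :=
    calc ∑ s, (W s).det ≤ ∑ _s : Fin k, (W t).det :=
          Finset.sum_le_sum fun s _ => ht s (Finset.mem_univ s)
      _ = (k : ℝ) * (W t).det := by
          rw [Finset.sum_const, Finset.card_univ, Fintype.card_fin, nsmul_eq_mul]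
  have hT : ∑ σ : Perm (Fin n), |∑ s, ∏ i, W s (σ i) i| ≤ (k : ℝ) * (W t).det := by
    rw [sum_abs_eq_sum_det W hrep]; exact hsum
  refine ⟨t, hT, ?_⟩
  -- the total mass is positive (the identity permutation contributes a positive term)
  have hpos : 0 < ∑ σ : Perm (Fin n), |∑ s, ∏ i, W s (σ i) i| := by
    have h1 : 0 < |∑ s, ∏ i, W s ((1 : Perm (Fin n)) i) i| := by
      rw [abs_eq_sign_mul_of_pos 1 _ (hrep 1)]; exact hrep 1
    have h2 : |∑ s, ∏ i, W s ((1 : Perm (Fin n)) i) i| ≤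
        ∑ σ : Perm (Fin n), |∑ s, ∏ i, W s (σ i) i| :=
      Finset.single_le_sum (f := fun σ : Perm (Fin n) => |∑ s, ∏ i, W s (σ i) i|)
        (fun σ _ => abs_nonneg _) (Finset.mem_univ (1 : Perm (Fin n)))
    exact lt_of_lt_of_le h1 h2
  have hk' : (0 : ℝ) < k := by exact_mod_cast hk
  nlinarith

/-! ## §3 Forster's inequality for the slice, balanced case -/

/-- **Forster's inequality for the permutation slice — BALANCED representations.**
Let `F(σ) = Σ_{t<k} Π_i W_t(σ i, i)` sign-represent `sgn` on `S_n`, and suppose the representation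
is `B`-balanced: every term is at most `B · |F(σ)|` in absolute value, and the values `|F(σ)|` are
within a factor `B` of each other. Then the twist `V` of largest determinant has `det V ≠ 0` and
`n! · per(V ∘ V) ≤ B³ · k² · det(V)²` — the conclusion of the registered stub `stub_forsterSlice` with
`k^C` replaced by `B³ k²` (so exponent `C = 3c + 2` when `B ≤ k^c`). The general stub (no balance
hypothesis) remains OPEN: short representations may be unbalanced, and the slice has no
isotropic-position step. [this file; pattern of Forster2002 Thm 2.2] -/
theorem forsterSlice_of_balanced (n k : ℕ) (W : Fin k → Matrix (Fin n) (Fin n) ℝ) (B : ℝ)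
    (hrep : ∀ σ : Perm (Fin n), 0 < ((Perm.sign σ : ℤ) : ℝ) * ∑ t, ∏ i, W t (σ i) i)
    (hterm : ∀ (σ : Perm (Fin n)) (t : Fin k),
      |∏ i, W t (σ i) i| ≤ B * |∑ s, ∏ i, W s (σ i) i|)
    (hflat : ∀ σ τ : Perm (Fin n), |∑ s, ∏ i, W s (σ i) i| ≤ B * |∑ s, ∏ i, W s (τ i) i|) :
    ∃ V : Matrix (Fin n) (Fin n) ℝ, V.det ≠ 0 ∧
      (n.factorial : ℝ) * (Matrix.of fun i j => V i j ^ 2).permanent ≤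
        B ^ 3 * (k : ℝ) ^ 2 * V.det ^ 2 := by
  -- notation-free abbreviations
  set F : Perm (Fin n) → ℝ := fun σ => ∑ s, ∏ i, W s (σ i) i with hF
  have hFpos : ∀ σ, 0 < |F σ| := fun σ => by
    simp only [hF]; rw [abs_eq_sign_mul_of_pos σ _ (hrep σ)]; exact hrep σ
  -- `B ≥ 1` from flatness at `σ = τ`
  have hB1 : 1 ≤ B := by
    have h := hflat 1 1
    have hp := hFpos 1
    simp only [hF] at hp
    nlinarith
  have hB0 : 0 ≤ B := le_trans zero_le_one hB1
  -- the twist of largest determinant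
  obtain ⟨t, hT, hdet⟩ := exists_det_ge_of_signRep W hrep
  set T : ℝ := ∑ σ : Perm (Fin n), |F σ| with hTdef
  have hT' : T ≤ (k : ℝ) * (W t).det := hT
  have hTnn : 0 ≤ T := Finset.sum_nonneg fun σ _ => abs_nonneg _
  refine ⟨W t, hdet.ne', ?_⟩
  -- a minimiser `σ₀` of `|F|`
  obtain ⟨σ₀, -, hσ₀⟩ := Finset.exists_min_image Finset.univ (fun σ => |F σ|)
    (Finset.univ_nonempty_iff.mpr ⟨(1 : Perm (Fin n))⟩)
  set m : ℝ := |F σ₀| with hm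
  have hm0 : 0 ≤ m := abs_nonneg _
  -- `n! · m ≤ T`
  have hcard : (Finset.univ : Finset (Perm (Fin n))).card = n.factorial := by
    rw [Finset.card_univ, Fintype.card_perm, Fintype.card_fin]
  have hnm : (n.factorial : ℝ) * m ≤ T :=
    calc (n.factorial : ℝ) * m = ∑ _σ : Perm (Fin n), m := by
          rw [Finset.sum_const, hcard, nsmul_eq_mul]
      _ ≤ T := Finset.sum_le_sum fun σ _ => hσ₀ σ (Finset.mem_univ σ)
  -- `|F σ| ≤ B · m` for all `σ`
  have hFle : ∀ σ, |F σ| ≤ B * m := fun σ => hflat σ σ₀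
  -- `per(V ∘ V) = Σ φ_t² ≤ B² Σ F² ≤ B² · (B m) · T`
  have hper : (Matrix.of fun i j => W t i j ^ 2).permanent ≤ B ^ 2 * (B * m) * T := by
    rw [← sum_prod_sq_eq_permanent (W t)]
    calc ∑ σ : Perm (Fin n), (∏ i, W t (σ i) i) ^ 2
        ≤ ∑ σ : Perm (Fin n), (B * |F σ|) ^ 2 := by
          refine Finset.sum_le_sum fun σ _ => ?_
          have h1 : |∏ i, W t (σ i) i| ≤ B * |F σ| := hterm σ t
          have h2 : 0 ≤ |∏ i, W t (σ i) i| := abs_nonneg _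
          calc (∏ i, W t (σ i) i) ^ 2 = |∏ i, W t (σ i) i| ^ 2 := (sq_abs _).symm
            _ ≤ (B * |F σ|) ^ 2 := pow_le_pow_left₀ h2 h1 2
      _ = ∑ σ : Perm (Fin n), B ^ 2 * (|F σ| * |F σ|) :=
          Finset.sum_congr rfl fun σ _ => by ring
      _ ≤ ∑ σ : Perm (Fin n), B ^ 2 * ((B * m) * |F σ|) := by
          refine Finset.sum_le_sum fun σ _ => ?_
          have := hFle σ
          have h0 : 0 ≤ |F σ| := abs_nonneg _
          have hB2 : 0 ≤ B ^ 2 := sq_nonneg _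
          exact mul_le_mul_of_nonneg_left (mul_le_mul_of_nonneg_right this h0) hB2
      _ = B ^ 2 * (B * m) * T := by
          rw [hTdef, Finset.mul_sum]
          refine Finset.sum_congr rfl fun σ _ => by ring
  -- assemble: `n! · per ≤ B³ · (n! m) · T ≤ B³ T² ≤ B³ k² det²`
  have hfac : (0 : ℝ) ≤ n.factorial := Nat.cast_nonneg _
  have hdet0 : 0 ≤ (W t).det := hdet.le
  have hTk : T * T ≤ ((k : ℝ) * (W t).det) * ((k : ℝ) * (W t).det) :=
    mul_le_mul hT' hT' hTnn (le_trans hTnn hT')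
  calc (n.factorial : ℝ) * (Matrix.of fun i j => W t i j ^ 2).permanent
      ≤ (n.factorial : ℝ) * (B ^ 2 * (B * m) * T) := mul_le_mul_of_nonneg_left hper hfac
    _ = B ^ 3 * ((n.factorial : ℝ) * m) * T := by ring
    _ ≤ B ^ 3 * T * T := by
        have hB3 : 0 ≤ B ^ 3 := pow_nonneg hB0 3
        exact mul_le_mul_of_nonneg_right (mul_le_mul_of_nonneg_left hnm hB3) hTnn
    _ = B ^ 3 * (T * T) := by ring
    _ ≤ B ^ 3 * (((k : ℝ) * (W t).det) * ((k : ℝ) * (W t).det)) :=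
        mul_le_mul_of_nonneg_left hTk (pow_nonneg hB0 3)
    _ = B ^ 3 * (k : ℝ) ^ 2 * (W t).det ^ 2 := by ring

end Summit.ValiantsHypothesis.ValiantsHypothesis.Theorems.SliceSignRank.SrkNotQP
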